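import Literature.Analysis.SegalBargmann.SchwartzHermiteDegreeComponents
import Literature.Analysis.SegalBargmann.SchwartzBargmannIntertwining
import HarnessLib

/-!
# Isotypic Schwartz vectors of a compact unitary action are limits of `B⁻¹` of homogeneous isotypic Fock polynomials

Topic `Analysis/SegalBargmann`; namespace `Literature.Analysis.SegalBargmann`.  The bridge between the Schwartz-side
density theorem `SchwartzHermiteDegreeComponents` (joint eigenspaces of degree-block operators are the closure of the
span of their HOMOGENEOUS members) and the polynomial Fock model (`SchwartzBargmannIntertwining`:
`unitaryOpPi U (binvPi F) = binvPi (linSubst (star U) F)`, Folland 1989 Prop. (4.39)).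

* §1 `Φ(V_d) = B⁻¹(𝓟_d)`: the transport `Φ = schwartzTransport euclE` of the degree block `V_d = span {h_β : |β| = d}`
  is `binvPi` of the homogeneous polynomials of degree `d` (`map_degBlock_le`, `map_homogeneousSubmodule_le`,
  `map_degBlock_eq`); `isHomogeneous_zeta`.
* §2 for a family of unitaries `U_i ∈ U(σ)`, weights `z_i` and eigenvalues `c_i`: the set `isotypicFockPolys U z c` of
  HOMOGENEOUS polynomials `G` with `z_i • (G ∘ U_i⁻¹) = c_i • G`; **main theorem**
  `mem_closure_span_binvPi_isotypic`: every `f ∈ 𝓢(ℝ^σ)` with `z_i • μ₀(U_i) f = c_i • f` for all `i` lies in the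
  closure of the span of `{binvPi G : G ∈ isotypicFockPolys U z c}`; with the converse
  (`smul_unitaryOpPi_binvPi_eq`) the joint eigenspace IS that closure (`setOf_isotypic_eq_closure_span`).
* §3 the same for a compact Weil representation `compactWeilRep ι χ` (weights = the vacuum character `χ`):
  `mem_closure_span_binvPi_of_compactWeilRep`.

This is Folland's description of the `K`-isotypic subspaces of the Schrödinger model through the Fock model
(Ch. 4 §5: the `U(n)`-decomposition `⊕ 𝓟_d`, isotypic components spanned by polynomial Fock vectors), in the
Schwartz topology.  Use (pub-hodgecm model cell, rows A12/A34, field `dense` of `HypSmoothSide`): the archimedean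
`κ`-isotypic Schwartz space is the closure of `binvPi` of the isotypic homogeneous Fock polynomials, which the
per-place classifications (`ClassicalInvariants/VectorCovectorUnitaryInvariants`, `FockRowDeterminantIsotypic`) and
`RepresentationTheory/PolynomialPlaceIsotypic` then list.  Everything is proved from the tree; no cited fact is
assumed.

## References

* [Folland1989] G. B. Folland, *Harmonic Analysis in Phase Space*, Annals of Mathematics Studies 122, Princeton UP
  (1989), Prop. (4.39) p. 161, Ch. 4 §5 pp. 182–195. [cite: Folland1989, Ch. 4 §5]
Provenance: LEAN-IN-TREE rule (2026-08-18), pub-hodgecm model-construction sub-cell, seat mc-binder-2 gen 5; KERNEL only.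
-/

set_option autoImplicit false

noncomputable section

open Complex SchwartzMap MeasureTheory Filter Topology MvPolynomial
open scoped BigOperators Real NNReal

namespace Literature.Analysis.SegalBargmann

variable {σ : Type*} [Fintype σ] [DecidableEq σ]

local notation "SE" σ => SchwartzMap (EuclideanSpace ℝ σ) ℂ
local notation "SR" σ => SchwartzMap (σ → ℝ) ℂ

/-! ## §1  Degree blocks are `B⁻¹` of homogeneous polynomials -/

section DegBlock

omit [DecidableEq σ] in
/-- `ζ_β = hcoef β • z^β` is homogeneous of degree `|β|`. [folklore] -/
theorem isHomogeneous_zeta (β : σ →₀ ℕ) : (zeta β).IsHomogeneous β.degree := by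
  rw [zeta]
  exact (homogeneousSubmodule σ ℂ β.degree).smul_mem _ (isHomogeneous_monomial (1 : ℂ) rfl)

omit [DecidableEq σ] in
/-- `(hcoef β : ℂ) ≠ 0`. [folklore] -/
theorem hcoef_coe_ne_zero (β : σ →₀ ℕ) : (hcoef β : ℂ) ≠ 0 :=
  Complex.ofReal_ne_zero.mpr (hcoef_pos β).ne'

/-- **`Φ(V_d) ⊆ B⁻¹(𝓟_d)`**: the transport to the Folland carrier of the degree block `V_d = span {h_β : |β| = d}` lies
in `binvPi` of the homogeneous polynomials of degree `d` (`Φ h_β = hermitePi β = binvPi ζ_β`).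
[cite: Folland1989, Ch. 4 §5] -/
theorem map_degBlock_le (d : ℕ) :
    (degBlock (σ := σ) d).map ((schwartzTransport (euclE σ)).toLinearEquiv : (SE σ) →ₗ[ℂ] SR σ) ≤
      (homogeneousSubmodule σ ℂ d).map binvPiₗ := by
  rw [degBlock, Submodule.map_span, Submodule.span_le]
  rintro _ ⟨_, ⟨⟨β, hβ⟩, rfl⟩, rfl⟩
  exact ⟨zeta β, (mem_homogeneousSubmodule d (zeta β)).mpr (hβ ▸ isHomogeneous_zeta β), rfl⟩

/-- **`B⁻¹(𝓟_d) ⊆ Φ(V_d)`**: conversely `binvPi` of a homogeneous polynomial of degree `d` is the transport of a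
member of `V_d` (`z^β = (hcoef β)⁻¹ ζ_β`). [cite: Folland1989, Ch. 4 §5] -/
theorem map_homogeneousSubmodule_le (d : ℕ) :
    (homogeneousSubmodule σ ℂ d).map binvPiₗ ≤
      (degBlock (σ := σ) d).map ((schwartzTransport (euclE σ)).toLinearEquiv : (SE σ) →ₗ[ℂ] SR σ) := by
  -- `𝓟_d ⊆ span {ζ_β : |β| = d}`
  have hP : homogeneousSubmodule σ ℂ d ≤
      Submodule.span ℂ (Set.range fun β : {β : σ →₀ ℕ // β.degree = d} => zeta β.1) := by
    intro G hG
    rw [mem_homogeneousSubmodule] at hG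
    rw [G.as_sum]
    refine Submodule.sum_mem _ fun β hβ => ?_
    have hdeg : β.degree = d := by
      rw [degree_eq_mdeg]; exact mdeg_eq_of_mem_support_of_isHomogeneous hG hβ
    have hmon : monomial β (coeff β G) = (coeff β G * ((hcoef β : ℂ))⁻¹) • zeta β := by
      rw [zeta, smul_smul, mul_assoc, inv_mul_cancel₀ (hcoef_coe_ne_zero β), mul_one, smul_monomial, smul_eq_mul, mul_one]
    rw [hmon]
    exact Submodule.smul_mem _ _ (Submodule.subset_span ⟨⟨β, hdeg⟩, rfl⟩)
  -- and `binvPi ζ_β = Φ h_β`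
  refine (Submodule.map_mono hP).trans ?_
  rw [Submodule.map_span, Submodule.span_le, degBlock, Submodule.map_span]
  rintro _ ⟨_, ⟨⟨β, hβ⟩, rfl⟩, rfl⟩
  exact Submodule.subset_span ⟨hermiteSchwartz (herm β), ⟨⟨β, hβ⟩, rfl⟩, rfl⟩

/-- **`Φ(V_d) = B⁻¹(𝓟_d)`.** [cite: Folland1989, Ch. 4 §5] -/
theorem map_degBlock_eq (d : ℕ) :
    (degBlock (σ := σ) d).map ((schwartzTransport (euclE σ)).toLinearEquiv : (SE σ) →ₗ[ℂ] SR σ) =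
      (homogeneousSubmodule σ ℂ d).map binvPiₗ :=
  le_antisymm (map_degBlock_le d) (map_homogeneousSubmodule_le d)

/-- Element form: a member of `V_d` transports to `binvPi G` with `G` homogeneous of degree `d`. [folklore] -/
theorem exists_binvPi_eq_of_mem_degBlock {d : ℕ} {F : SE σ} (hF : F ∈ degBlock (σ := σ) d) :
    ∃ G : MvPolynomial σ ℂ, G.IsHomogeneous d ∧ binvPi G = schwartzTransport (euclE σ) F := by
  obtain ⟨G, hG, hGF⟩ := map_degBlock_le d ⟨F, hF, rfl⟩
  exact ⟨G, (mem_homogeneousSubmodule d G).mp hG, by rw [← binvPiₗ_apply]; exact hGF⟩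

end DegBlock

/-! ## §2  Joint eigenvectors of a family of unitaries -/

section Isotypic

variable {ι : Type*} (U : ι → Matrix.unitaryGroup σ ℂ) (z c : ι → ℂ)

/-- **The homogeneous isotypic Fock polynomials** of the family: homogeneous `G` with `z_i • (G ∘ U_i⁻¹) = c_i • G`
for every `i` (`G ∘ U⁻¹ = linSubst (star U) G`). [cite: Folland1989, Ch. 4 §5] -/
def isotypicFockPolys : Set (MvPolynomial σ ℂ) :=
  {G | (∃ d, G.IsHomogeneous d) ∧ ∀ i, z i • linSubst (star (U i : Matrix σ σ ℂ)) G = c i • G}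

/-- Membership. [folklore] -/
theorem mem_isotypicFockPolys {G : MvPolynomial σ ℂ} :
    G ∈ isotypicFockPolys U z c ↔
      (∃ d, G.IsHomogeneous d) ∧ ∀ i, z i • linSubst (star (U i : Matrix σ σ ℂ)) G = c i • G := Iff.rfl

/-- `binvPi` is injective. [folklore] -/
theorem binvPi_injective : Function.Injective (binvPi (σ := σ)) :=
  fun _ _ h => binv_injective (hermiteSchwartzPi_injective h)

/-- Transport of `μ₀(U)`: `Φ (unitaryOpE U F) = unitaryOpPi U (Φ F)`. [folklore] -/
theorem schwartzTransport_unitaryOpE (V : Matrix.unitaryGroup σ ℂ) (F : SE σ) :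
    schwartzTransport (euclE σ) (unitaryOpE V F) = unitaryOpPi V (schwartzTransport (euclE σ) F) := by
  rw [unitaryOpPi_apply, ContinuousLinearEquiv.symm_apply_apply]

/-- **The converse direction**: `binvPi G` of an isotypic polynomial is a joint eigenvector,
`z_i • μ₀(U_i) (B⁻¹G) = c_i • B⁻¹G`. [cite: Folland1989, Prop (4.39)] -/
theorem smul_unitaryOpPi_binvPi_eq {G : MvPolynomial σ ℂ}
    (hG : ∀ i, z i • linSubst (star (U i : Matrix σ σ ℂ)) G = c i • G) (i : ι) :
    z i • unitaryOpPi (U i) (binvPi G) = c i • binvPi G := by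
  rw [unitaryOpPi_binvPi, ← binvPi_smul, hG i, binvPi_smul]

/-- **The homogeneous joint eigenvectors transport into `binvPi` of the isotypic Fock polynomials.**
[cite: Folland1989, Ch. 4 §5] -/
theorem image_blockEigenspaceHomogeneous_subset :
    schwartzTransport (euclE σ) '' blockEigenspaceHomogeneous (fun i => isBlockKernel_uKernel (U i)) z c ⊆
      binvPi '' isotypicFockPolys U z c := by
  rintro _ ⟨F, ⟨hFE, d, hFd⟩, rfl⟩
  obtain ⟨G, hG, hΦ⟩ := exists_binvPi_eq_of_mem_degBlock hFd
  refine ⟨G, ⟨⟨d, hG⟩, fun i => ?_⟩, hΦ⟩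
  have h' : z i • unitaryOpE (U i) F = c i • F := hFE i
  have h2 := congrArg (schwartzTransport (euclE σ)) h'
  rw [map_smul, map_smul, schwartzTransport_unitaryOpE, ← hΦ, unitaryOpPi_binvPi, ← binvPi_smul,
    ← binvPi_smul] at h2
  exact binvPi_injective h2

/-- **Main theorem: a joint eigenvector `f ∈ 𝓢(ℝ^σ)` of the operators `z_i • μ₀(U_i)` (eigenvalues `c_i`) is a
limit, in the Schwartz topology, of finite combinations of `B⁻¹G`, `G` a HOMOGENEOUS isotypic Fock polynomial.**
[cite: Folland1989, Ch. 4 §5] -/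
theorem mem_closure_span_binvPi_isotypic {f : SR σ} (hf : ∀ i, z i • unitaryOpPi (U i) f = c i • f) :
    f ∈ closure (Submodule.span ℂ (binvPi '' isotypicFockPolys U z c) : Set (SR σ)) := by
  have h1 := mem_closure_span_image_homogeneous (schwartzTransport (euclE σ))
    (fun i => isBlockKernel_uKernel (U i)) z c (x := f) (fun i => hf i)
  exact closure_mono (SetLike.coe_subset_coe.mpr
    (Submodule.span_mono (image_blockEigenspaceHomogeneous_subset U z c))) h1

/-- The joint eigenspace is closed. [folklore] -/
theorem isClosed_setOf_isotypic : IsClosed {f : SR σ | ∀ i, z i • unitaryOpPi (U i) f = c i • f} := by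
  rw [Set.setOf_forall]
  exact isClosed_iInter fun i =>
    isClosed_eq ((unitaryOpPi (U i)).continuous.const_smul (z i)) (continuous_const_smul (c i))

/-- **The joint eigenspace IS the closure of the span of `binvPi` of the homogeneous isotypic Fock polynomials.**
[cite: Folland1989, Ch. 4 §5] -/
theorem setOf_isotypic_eq_closure_span :
    {f : SR σ | ∀ i, z i • unitaryOpPi (U i) f = c i • f} =
      closure (Submodule.span ℂ (binvPi '' isotypicFockPolys U z c) : Set (SR σ)) := by
  refine Set.Subset.antisymm (fun f hf => mem_closure_span_binvPi_isotypic U z c hf)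
    (closure_minimal ?_ (isClosed_setOf_isotypic U z c))
  intro f hf
  induction hf using Submodule.span_induction with
  | mem g hg =>
    obtain ⟨G, hG, rfl⟩ := hg
    exact fun i => smul_unitaryOpPi_binvPi_eq U z c hG.2 i
  | zero => intro i; simp only [map_zero, smul_zero]
  | add f g _ _ hf hg => intro i; rw [map_add, smul_add, hf i, hg i, smul_add]
  | smul a f _ hf => intro i; rw [map_smul, smul_comm, hf i, smul_comm]

end Isotypic

/-! ## §3  Compact Weil representations -/

section Compact

variable {H : Type*} [Group H] (ιH : H →* Matrix.unitaryGroup σ ℂ) (χ : H →* Circle) (c : H → ℂ)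

/-- **For `ω = compactWeilRep ι χ`** (`ω(h) = χ(h) • μ₀(ι h)`): an `ω`-eigenvector with eigenvalues `c h` is a limit of
combinations of `B⁻¹G`, `G` homogeneous with `χ(h) • (G ∘ (ι h)⁻¹) = c(h) • G`. [cite: Folland1989, Ch. 4 §5] -/
theorem mem_closure_span_binvPi_of_compactWeilRep {f : SR σ} (hf : ∀ h, compactWeilRep ιH χ h f = c h • f) :
    f ∈ closure (Submodule.span ℂ
      (binvPi '' isotypicFockPolys (fun h => ιH h) (fun h => ((χ h : Circle) : ℂ)) c) : Set (SR σ)) :=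
  mem_closure_span_binvPi_isotypic _ _ _ fun h => by rw [← compactWeilRep_apply]; exact hf h

/-- And the `ω`-eigenspace is exactly that closure. [cite: Folland1989, Ch. 4 §5] -/
theorem setOf_compactWeilRep_eq_closure_span :
    {f : SR σ | ∀ h, compactWeilRep ιH χ h f = c h • f} =
      closure (Submodule.span ℂ
        (binvPi '' isotypicFockPolys (fun h => ιH h) (fun h => ((χ h : Circle) : ℂ)) c) : Set (SR σ)) := by
  rw [← setOf_isotypic_eq_closure_span]
  rfl

end Compact

/-! ## §4  Other carriers: adapted frames `e : D ≃L[ℝ] ℝ^σ` (`follandFock e G = (schwartzTransport e)⁻¹ (binvPi G)`) -/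

section Frame

variable {D : Type*} [NormedAddCommGroup D] [NormedSpace ℝ D]
variable {ι : Type*} (e : D ≃L[ℝ] (σ → ℝ)) (V : ι → Matrix.unitaryGroup σ ℂ) (w c : ι → ℂ)

/-- **Operators of the rigidity shape** `A_i = w_i • (e^*)⁻¹ ∘ μ₀(V_i) ∘ e^*` on `𝓢(D)` (tree
`Weil1964.ArchFollandCompactKType.apply_eq_vacCoeffU_smul_of_unitaryCovariant`): their eigen-equations are the
eigen-equations of `w_i • μ₀(V_i)` for the transported function. [cite: Folland1989, Prop (4.39)] -/
theorem forall_eigen_iff_of_frame {A : ι → (𝓢(D, ℂ) →ₗ[ℂ] 𝓢(D, ℂ))}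
    (hA : ∀ i f, A i f = w i • (schwartzTransport e).symm (unitaryOpPi (V i) (schwartzTransport e f)))
    (f : 𝓢(D, ℂ)) :
    (∀ i, A i f = c i • f) ↔
      ∀ i, w i • unitaryOpPi (V i) (schwartzTransport e f) = c i • schwartzTransport e f := by
  refine forall_congr' fun i => ?_
  rw [hA i f]
  constructor
  · intro h
    have h2 := congrArg (schwartzTransport e) h
    rwa [map_smul, map_smul, ContinuousLinearEquiv.apply_symm_apply] at h2
  · intro h
    apply (schwartzTransport e).injective
    rw [map_smul, map_smul, ContinuousLinearEquiv.apply_symm_apply]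
    exact h

/-- **Frame form of the main theorem: the joint eigenspace of the operators `w_i • (e^*)⁻¹ μ₀(V_i) e^*` on `𝓢(D)`
IS the closure of the span of the Folland–Fock vectors `(e^*)⁻¹ (B⁻¹ G)` of the homogeneous isotypic Fock
polynomials `G`** (`w_i • (G ∘ V_i⁻¹) = c_i • G`). [cite: Folland1989, Ch. 4 §5] -/
theorem setOf_eigen_eq_closure_span_of_frame {A : ι → (𝓢(D, ℂ) →ₗ[ℂ] 𝓢(D, ℂ))}
    (hA : ∀ i f, A i f = w i • (schwartzTransport e).symm (unitaryOpPi (V i) (schwartzTransport e f))) :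
    {f : 𝓢(D, ℂ) | ∀ i, A i f = c i • f} =
      closure (Submodule.span ℂ
        ((fun G => (schwartzTransport e).symm (binvPi G)) '' isotypicFockPolys V w c) : Set 𝓢(D, ℂ)) := by
  have hset : {f : 𝓢(D, ℂ) | ∀ i, A i f = c i • f} =
      (schwartzTransport e).symm '' {g : SR σ | ∀ i, w i • unitaryOpPi (V i) g = c i • g} := by
    ext f
    rw [Set.mem_setOf_eq, forall_eigen_iff_of_frame e V w c hA]
    constructor
    · intro h
      exact ⟨schwartzTransport e f, h, (schwartzTransport e).symm_apply_apply f⟩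
    · rintro ⟨g, hg, rfl⟩
      simpa only [Set.mem_setOf_eq, ContinuousLinearEquiv.apply_symm_apply] using hg
  have himg : (schwartzTransport e).symm ''
      (Submodule.span ℂ (binvPi '' isotypicFockPolys V w c) : Set (SR σ)) =
      (Submodule.span ℂ ((fun G => (schwartzTransport e).symm (binvPi G)) '' isotypicFockPolys V w c) :
        Set 𝓢(D, ℂ)) := by
    have h1 : (fun G => (schwartzTransport e).symm (binvPi G)) '' isotypicFockPolys V w c =
        (schwartzTransport e).symm '' (binvPi '' isotypicFockPolys V w c) := (Set.image_image _ _ _).symm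
    set L : (SR σ) →ₗ[ℂ] 𝓢(D, ℂ) := ((schwartzTransport e).symm.toLinearEquiv : (SR σ) →ₗ[ℂ] 𝓢(D, ℂ)) with hLdef
    have hL : (L : (SR σ) → 𝓢(D, ℂ)) = (schwartzTransport e).symm := rfl
    rw [h1, ← hL, Submodule.span_image, Submodule.map_coe]
  rw [hset, setOf_isotypic_eq_closure_span, ← himg]
  exact (schwartzTransport e).symm.toHomeomorph.image_closure _

/-- Membership form. [cite: Folland1989, Ch. 4 §5] -/
theorem mem_closure_span_of_frame {A : ι → (𝓢(D, ℂ) →ₗ[ℂ] 𝓢(D, ℂ))}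
    (hA : ∀ i f, A i f = w i • (schwartzTransport e).symm (unitaryOpPi (V i) (schwartzTransport e f)))
    {f : 𝓢(D, ℂ)} (hf : ∀ i, A i f = c i • f) :
    f ∈ closure (Submodule.span ℂ
      ((fun G => (schwartzTransport e).symm (binvPi G)) '' isotypicFockPolys V w c) : Set 𝓢(D, ℂ)) := by
  rw [← setOf_eigen_eq_closure_span_of_frame e V w c hA]
  exact hf

end Frame

end Literature.Analysis.SegalBargmann

end
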